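import Literature.AnabelianGeometry.EtaleTheta.SettingModelOriginProfile

/-!
# [EtTh] Thm. 1.6 (i) at the root NV model: the K3 assembly instantiated, and the kernel certificate
# that its genuine-model inputs are load-bearing

ROW «K3 AT THE ROOT MODEL» (abc-iut-L2-lead gen 3, R44), part (b).

(1) `model_thm16i_of` — abc-iut-L6-d5's K3 assembly of Thm. 1.6 (i) (`Thm16Sub.thm16i_of_isKernelOfAction`,
leaves L02 + L04 + L05 + [SemiAnbd] 6.5 (iii)) INSTANTIATED at `Dα = Dβ = ThetaSetting.model p`, with
the clauses that hold at the toy DISCHARGED: L04 at `N = 2` (`SettingModel.model_gknIsKernelOfAction_two`,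
from TM₂, p421863), R2 (`model_gtpYNFromCusp`, vacuous) and Thm. 6.5 (iii) (`model_isoPreservesCuspidalDecomp`,
vacuous). The residual named hypotheses are EXACTLY R1 (`KerToZIsCompactlyGenerated`) and the cusp of
`X^log` — and both are REFUTED at this model (`not_kerToZIsCompactlyGenerated_model`,
`not_exists_cuspidal_le_GtpY_model`, `SettingModelOriginProfile.lean`), so the instance is vacuous there:
it is displayed only as the honest list of what Thm. 1.6 (i) needs beyond the root interface.

(2) That residue is NOT an artefact of the assembly: `exists_deltaPreserving_not_thm16i` exhibits a
`Δ^tp_X`-preserving topological automorphism `γ` of the toy's `Π^tp_X = F₂ × G_{ℚ_p}` (the generator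
swap `a ↔ b` on `F₂`, identity on `G_{ℚ_p}`; continuous because `Π^tp_X` is discrete) with
`γ(Π^tp_Y) ≠ Π^tp_Y` and `γ(Π^tp_Ÿ) ≠ Π^tp_Ÿ`, i.e. `¬ Thm16i γ`. Consequently
(`map_GtpY_not_derivable`, `thm16i_not_derivable`) neither step L02 («`γ(Π^tp_{Yα}) = Π^tp_{Yβ}`») nor
Thm. 1.6 (i) is a consequence of: the root `ThetaSetting` + the guard `IsEtThOrigin` + [AbsAnab] Lem. 1.3.8
(`hΔ`) + [SemiAnbd] Thm. 6.5 (iii) + L04 at `N = 2` + R2 + R3 (all of which the toy satisfies). The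
printed inputs that the toy violates — R1 («`Z` from the dual graph of the special fibre», [SemiAnbd]
Thm. 3.7 (iv)) and the cusp of the type-`(1,1)` curve `X^log` — are therefore genuinely load-bearing in
the proof of Thm. 1.6 (i) (p. 24: «immediate from the definitions; the discreteness of “Z”»), in the
sense of abc-iut-L2-t1's independence certificates (`SettingModelIndependence.lean`, p421746).

Proof-only (no definitions; the automorphism is built inside the proofs). Consistency/independence
evidence about a toy model; typed ≠ proved for the paper's objects; no side is taken on [IUTchIII]
Cor. 3.12.
-/

namespace Literature.AnabelianGeometry.EtaleTheta.SettingModel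

open Literature.AnabelianGeometry.SemiGraphs Thm16Sub Topology

variable (p : ℕ) [Fact p.Prime]

/-- **The K3 assembly of Thm. 1.6 (i) at the toy, residual hypotheses displayed.** With L04 (`N = 2`), R2
and [SemiAnbd] 6.5 (iii) discharged at `ThetaSetting.model p`, Thm. 1.6 (i) for a `Δ^tp_X`-preserving
self-isomorphism `γ` needs exactly R1 (`hZ`) and a cusp of `X^log` inside `Π^tp_Y` (`hex`). VACUOUS at this
model — both `hZ` and `hex` are refuted there (`not_kerToZIsCompactlyGenerated_model`,
`not_exists_cuspidal_le_GtpY_model`); genuine models of the §1 setting are expected to supply them.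
[cite: MochizukiEtTh2009, Thm 1.6 (i) p.24] -/
theorem model_thm16i_of (γ : (ThetaSetting.model p).PiTemp ≃ₜ* (ThetaSetting.model p).PiTemp)
    (hΔ : (ThetaSetting.model p).DeltaTemp.map γ.toMulEquiv.toMonoidHom =
      (ThetaSetting.model p).DeltaTemp)
    (hZ : KerToZIsCompactlyGenerated (ThetaSetting.model p))
    (hex : ∃ Dc : Subgroup (ThetaSetting.model p).PiTemp,
      (ThetaSetting.model p).IsCuspidalDecompositionGroup Dc ∧ Dc ≤ (ThetaSetting.model p).GtpY) :
    ThetaSetting.Thm16i γ :=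
  thm16i_of_isKernelOfAction γ hΔ hZ hZ (model_gknIsKernelOfAction_two p)
    (model_gknIsKernelOfAction_two p) (model_gtpYNFromCusp p 2) (model_gtpYNFromCusp p 2)
    (model_isoPreservesCuspidalDecomp p) hex

/-- **A `Δ^tp_X`-preserving automorphism of the toy violating L02 and Thm. 1.6 (i).** The generator swap
`a ↔ b` of `F₂` (times the identity of `G_{ℚ_p}`) is a topological automorphism of the discrete
`Π^tp_X = F₂ × G_{ℚ_p}` preserving `Δ^tp_X = F₂ × 1`; it carries `(b, 1) ∈ Π^tp_Y = Ker(a-exponent)` to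
`(a, 1) ∉ Π^tp_Y`, and `(b², 1) ∈ Π^tp_{Y₂} = Π^tp_Ÿ` to `(a², 1) ∉ Π^tp_Y ⊇ Π^tp_Ÿ`.
[cite: MochizukiEtTh2009, Thm 1.6 (i) p.24] -/
theorem exists_deltaPreserving_not_thm16i :
    ∃ γ : (ThetaSetting.model p).PiTemp ≃ₜ* (ThetaSetting.model p).PiTemp,
      (ThetaSetting.model p).DeltaTemp.map γ.toMulEquiv.toMonoidHom = (ThetaSetting.model p).DeltaTemp ∧
      (ThetaSetting.model p).GtpY.map γ.toMulEquiv.toMonoidHom ≠ (ThetaSetting.model p).GtpY ∧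
      ¬ ThetaSetting.Thm16i γ := by
  -- the swap of the two generators of `F₂`, transported to `Δ := F₂` and to `Π^tp_X = Δ × Γ`
  let s : F₂ ≃* F₂ := FreeGroup.freeGroupCongr (Equiv.swap (0 : Fin 2) 1)
  have hs1 : s (FreeGroup.of 1) = FreeGroup.of 0 := by
    change FreeGroup.map _ (FreeGroup.of 1) = FreeGroup.of 0
    rw [FreeGroup.map.of, Equiv.swap_apply_right]
  let sD : Del ≃* Del :=
    { toFun := fun g => Del.ofF₂ (s (Del.val g))
      invFun := fun g => Del.ofF₂ (s.symm (Del.val g))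
      left_inv := fun g => by
        change Del.ofF₂ (s.symm (Del.val (Del.ofF₂ (s (Del.val g))))) = g
        rw [Del.val_ofF₂, MulEquiv.symm_apply_apply]; rfl
      right_inv := fun g => by
        change Del.ofF₂ (s (Del.val (Del.ofF₂ (s.symm (Del.val g))))) = g
        rw [Del.val_ofF₂, MulEquiv.apply_symm_apply]; rfl
      map_mul' := fun g h => by rw [map_mul, map_mul, map_mul] }
  have hsD : ∀ g : Del, Del.val (sD g) = s (Del.val g) := fun _ => rfl
  let γm : PiTp p ≃* PiTp p := MulEquiv.prodCongr sD (MulEquiv.refl (Gam p))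
  let γ : (ThetaSetting.model p).PiTemp ≃ₜ* (ThetaSetting.model p).PiTemp :=
    { γm with
      continuous_toFun := continuous_of_discreteTopology
      continuous_invFun := continuous_of_discreteTopology }
  have hγ : ∀ g : PiTp p, γ.toMulEquiv.toMonoidHom g = (sD g.1, g.2) := fun _ => rfl
  -- `b ↦ a`
  obtain ⟨db, hdb⟩ := Del.val_bijective.2 (FreeGroup.of 1)
  have hdbs : Del.val (sD db) = FreeGroup.of 0 := by rw [hsD, hdb, hs1]
  refine ⟨γ, ?_, ?_, ?_⟩
  · -- `Δ^tp_X = {g | g.2 = 1}` is preserved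
    ext x
    constructor
    · rintro ⟨y, hy, rfl⟩
      rw [hγ]
      exact (mem_deltaTemp_iff p _).mpr ((mem_deltaTemp_iff p y).mp hy)
    · intro hx
      refine ⟨γ.toMulEquiv.symm x, ?_, by simp⟩
      exact (mem_deltaTemp_iff p _).mpr ((mem_deltaTemp_iff p x).mp hx)
  · -- `(b, 1) ∈ Π^tp_Y` goes to `(a, 1) ∉ Π^tp_Y`
    intro hY
    have hb : ((db, 1) : PiTp p) ∈ (ThetaSetting.model p).GtpY := by
      change ((db, 1) : PiTp p) ∈ (toZM p).ker
      rw [MonoidHom.mem_ker, toZM_apply]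
      change Multiplicative.ofAdd (heisHom (Del.val db)).x = 1
      rw [hdb, heisHom_of_one]; rfl
    have ha : γ.toMulEquiv.toMonoidHom (db, 1) ∈ (ThetaSetting.model p).GtpY :=
      hY ▸ Subgroup.mem_map_of_mem _ hb
    rw [hγ] at ha
    change ((sD db, (1 : Gam p)) : PiTp p) ∈ (toZM p).ker at ha
    rw [MonoidHom.mem_ker, toZM_apply] at ha
    change Multiplicative.ofAdd (heisHom (Del.val (sD db))).x = 1 at ha
    rw [hdbs, heisHom_of_zero] at ha
    exact one_ne_zero (ofAdd_eq_one.mp ha)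
  · -- `(b², 1) ∈ Π^tp_Ÿ = Π^tp_{Y₂}` goes to `(a², 1) ∉ Π^tp_Y`
    intro hThm
    have hw : ((db ^ 2, 1) : PiTp p) ∈ (ThetaSetting.model p).GtpYdd := by
      rw [GtpYdd_eq_GtpYN_two]
      change ((db ^ 2, 1) : PiTp p) ∈ YN p 2
      refine Subgroup.mem_prod.mpr ⟨?_, one_mem _⟩
      change heisHom (Del.val (db ^ 2)) ∈ heisYN ((2 : ℕ+) : ℕ)
      rw [map_pow, hdb, map_pow, heisHom_of_one]
      refine ⟨?_, ?_⟩
      · simp [pow_two]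
      · change ((2 : ℕ) : ℤ) ∣ ((⟨0, 1, 0⟩ : Heis ℤ) ^ 2).y
        simp [pow_two]
    have hγw : γ.toMulEquiv.toMonoidHom (db ^ 2, 1) ∈ (ThetaSetting.model p).GtpY :=
      (ThetaSetting.model p).GtpYdd_le_GtpY (hThm ▸ Subgroup.mem_map_of_mem _ hw)
    rw [hγ] at hγw
    change ((sD (db ^ 2), (1 : Gam p)) : PiTp p) ∈ (toZM p).ker at hγw
    rw [MonoidHom.mem_ker, toZM_apply] at hγw
    change Multiplicative.ofAdd (heisHom (Del.val (sD (db ^ 2)))).x = 1 at hγw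
    rw [map_pow, map_pow, hdbs, map_pow, heisHom_of_zero, ofAdd_eq_one] at hγw
    simp [pow_two] at hγw

/-- **L02 is not a consequence of root + guard + `hΔ`.** «`γ(Π^tp_{Yα}) = Π^tp_{Yβ}`» (Thm. 1.6 (i),
p. 24, «immediate from the definitions … the discreteness of “Z”») FAILS for some `Δ^tp_X`-preserving
isomorphism between settings satisfying `IsEtThOrigin`: the printed input R1 («`Z` from the dual graph»,
`Thm16Sub.KerToZIsCompactlyGenerated`, under which abc-iut-L6-d5's `map_GtpY_eq_of_kerToZ` proves L02) is
load-bearing. [cite: MochizukiEtTh2009, Thm 1.6 (i) p.24] -/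
theorem map_GtpY_not_derivable :
    ¬ ∀ (Dα Dβ : ThetaSetting p) (γ : Dα.PiTemp ≃ₜ* Dβ.PiTemp),
        Dα.IsEtThOrigin → Dβ.IsEtThOrigin →
        Dα.DeltaTemp.map γ.toMulEquiv.toMonoidHom = Dβ.DeltaTemp →
        Dα.GtpY.map γ.toMulEquiv.toMonoidHom = Dβ.GtpY := by
  intro H
  obtain ⟨γ, hΔ, hY, -⟩ := exists_deltaPreserving_not_thm16i p
  exact hY (H _ _ γ (ThetaSetting.model_isEtThOrigin p) (ThetaSetting.model_isEtThOrigin p) hΔ)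

/-- **Thm. 1.6 (i) is not a consequence of root + guard + [AbsAnab] 1.3.8 + [SemiAnbd] 6.5 (iii) + L04₂ +
R2 + R3.** All these hypotheses hold at the toy for the swap automorphism, and `Thm16i` fails there; so
the remaining printed inputs of the K3 assembly — R1 and the cusp of `X^log` (the clauses of
`IsThm16Origin` that are «genuine models only») — carry weight. [cite: MochizukiEtTh2009, Thm 1.6 (i) p.24] -/
theorem thm16i_not_derivable :
    ¬ ∀ (Dα Dβ : ThetaSetting p) (γ : Dα.PiTemp ≃ₜ* Dβ.PiTemp),
        Dα.IsEtThOrigin → Dβ.IsEtThOrigin →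
        Dα.DeltaTemp.map γ.toMulEquiv.toMonoidHom = Dβ.DeltaTemp →
        Dα.IsoPreservesCuspidalDecomp Dβ.toTemperedCurve →
        GKNIsKernelOfAction Dα 2 → GKNIsKernelOfAction Dβ 2 →
        (∀ N : ℕ+, GtpYNFromCusp Dα N) → (∀ N : ℕ+, GtpYNFromCusp Dβ N) →
        Topology.IsQuotientMap Dα.toTheta → Topology.IsQuotientMap Dβ.toTheta →
        Topology.IsQuotientMap Dα.thetaToEll → Topology.IsQuotientMap Dβ.thetaToEll →
        ThetaSetting.Thm16i γ := by
  intro H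
  obtain ⟨γ, hΔ, -, hThm⟩ := exists_deltaPreserving_not_thm16i p
  exact hThm (H _ _ γ (ThetaSetting.model_isEtThOrigin p) (ThetaSetting.model_isEtThOrigin p) hΔ
    (model_isoPreservesCuspidalDecomp p) (model_gknIsKernelOfAction_two p)
    (model_gknIsKernelOfAction_two p) (model_gtpYNFromCusp p) (model_gtpYNFromCusp p)
    (model_isQuotientMap_toTheta p) (model_isQuotientMap_toTheta p)
    (model_isQuotientMap_thetaToEll p) (model_isQuotientMap_thetaToEll p))

/-- **Contrast: the companion of Thm. 1.6 (ii) DOES exist at the toy for every `Δ^tp_X`-preserving `γ`**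
(non-vacuous — in particular for the swap automorphism of `exists_deltaPreserving_not_thm16i`): rows
L09/L10 of the K3 sub-DAG are consequences of the root + R3 (abc-iut-L6-d5's
`thetaCompanion_of_isQuotientMap`, with R3 := `model_isQuotientMap_toTheta`), whereas L02 and (i) are
not consequences of the root + everything the toy satisfies. [cite: MochizukiEtTh2009, Thm 1.6 (ii) p.24] -/
theorem model_nonempty_thetaCompanion
    (γ : (ThetaSetting.model p).PiTemp ≃ₜ* (ThetaSetting.model p).PiTemp)
    (hΔ : (ThetaSetting.model p).DeltaTemp.map γ.toMulEquiv.toMonoidHom =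
      (ThetaSetting.model p).DeltaTemp) :
    Nonempty (ThetaSetting.ThetaCompanion γ) :=
  ⟨thetaCompanion_of_isQuotientMap (ThetaSetting.model p) (ThetaSetting.model p) γ hΔ
    (model_isQuotientMap_toTheta p) (model_isQuotientMap_toTheta p)⟩

/-- **Summary at the toy**: a setting satisfying the guard, L04₂, R2, R3 and [SemiAnbd] 6.5 (iii) for
itself, with a `Δ^tp_X`-preserving self-isomorphism that HAS a theta companion (Thm. 1.6 (ii)) and yet
violates Thm. 1.6 (i). [cite: MochizukiEtTh2009, Thm 1.6 (i) p.24] -/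
theorem exists_isEtThOrigin_not_thm16i :
    ∃ (D : ThetaSetting p) (γ : D.PiTemp ≃ₜ* D.PiTemp), D.IsEtThOrigin ∧
      D.DeltaTemp.map γ.toMulEquiv.toMonoidHom = D.DeltaTemp ∧
      D.IsoPreservesCuspidalDecomp D.toTemperedCurve ∧ GKNIsKernelOfAction D 2 ∧
      (∀ N : ℕ+, GtpYNFromCusp D N) ∧ Topology.IsQuotientMap D.toTheta ∧
      Topology.IsQuotientMap D.thetaToEll ∧ Nonempty (ThetaSetting.ThetaCompanion γ) ∧
      ¬ ThetaSetting.Thm16i γ := by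
  obtain ⟨γ, hΔ, -, hThm⟩ := exists_deltaPreserving_not_thm16i p
  exact ⟨ThetaSetting.model p, γ, ThetaSetting.model_isEtThOrigin p, hΔ,
    model_isoPreservesCuspidalDecomp p, model_gknIsKernelOfAction_two p, model_gtpYNFromCusp p,
    model_isQuotientMap_toTheta p, model_isQuotientMap_thetaToEll p,
    model_nonempty_thetaCompanion p γ hΔ, hThm⟩

end Literature.AnabelianGeometry.EtaleTheta.SettingModel
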